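import Summits.QuantumFields.YangMills.Theorems.BalabanUVNodesK0RecordFormatNamesLocE
import Summits.QuantumFields.YangMills.Theorems.BalabanUVNodesPortU8LDressResponse
import Summits.QuantumFields.YangMills.Theorems.BalabanUVNodesPortS1Sect4WardRows
import Literature.MathematicalPhysics.QuantumFieldTheory.Balaban1983to89.B12ChartGaugeFlow48
import Summits.QuantumFields.YangMills.Theorems.BalabanUVNodesK0AxTransverseWardRoadTraceRecord

/-!
# NODE O cover — LENS-1 («cauchy-analytic») g7, NODE v8 EXIT (δ): LEAF (C)♯ «RowLᵀ♯» TYPED AT THE RECORD's NAMES, and its reduction under P0 to a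
# TABLE IDENTITY (C-tab) «the Landau-dressed rooted response table and the whole-torus (2.35) response table differ by a lattice gradient»

Cell `ym-nodeO-ideate`, ideator seat `ymgap-nodeO-lens-1` g7 (count-neutral; HOME file, not a proposal).  Companion of NODE v8∕v8.1 (`nodeO-cover/LENS-1-NODE-v8.md`
f2244a109c013aec, `…v8.1.md` 32503048dae68768), of the (δ) road ((L) ✓p812753 `B12ChartGaugeFlow48`, (T) `…K0AxTransverseWard(Road)`, ★ PTB-1 g4) and of leaf (B)
`nodeO-cover/LENS-1-GaugeFlowRec-v1(.1).lean` (600f5219c8e2c257 ∕ v1.1).  [I] = [Balaban1987RG1], [15] = [Balaban1985Variational], [B6] = [Balaban1984PropagatorsII].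

WHAT THIS FILE IS.  Four `Prop`-valued RECEIPTS (displayed, assert nothing) + bookkeeping theorems, all over TREE names:
* §1 `recordGradLeg F K λ` — the lattice-gradient leg family (VERBATIM the decl of `LENS-1-GaugeFlowRec-v1.lean` :108; NAME RULE O-9: alias on landing).
* §2 (C)  `ResponseRowAtLT F θ k K a`      — RowLᵀ AT THE RECORD: `∀ l, ∃ φ, D(recordEmbL)(0)·(δ_l ⊗ bV a) − recordGkLocWξ univ a l = recordGradLeg φ` (the honest legs of ⁸'s
  Landau-dressed chart and ★ PTB-1's WHOLE-TORUS chart-unit transverse table (ed.17 `recordResponse9DataFromLocUnivξ`'s `Gk`) differ by a pure-gauge leg), byte-parallel to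
  ed.14's (E4a) `ResponseRowAtL` (NamesLDress :109);
  (C)♯ `ResponseRowAtLTSymm F θ k K a` — the same MODULO ONE GLOBAL ROTATION `recordAdJ h`, `h ∈ SU(2)` constant (◆ CRIT-1 V-CRIT1-g35-v8's optional `Ad`-sharpening; the
  legal form of the root's surviving constant conjugation);
  (C-tab) `TableRowLT F θ k K a` ∕ (C-tab)♯ `TableRowLTSymm F θ k K a` — the TABLE IDENTITIES `recordGkL a l − recordGkLocWξ univ a l = recordGradLeg φ` (resp. with `recordAdJ h`):
  no `fderiv`, two NAMED tables; = ★★ DEF-1 g35's toy identity «`Hr − ξ·hOp = ∂φ*`» (residual 3e-11 at (3,9); ◆ (3,11) same) read as a statement.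
* §3 BOOKKEEPING: `recordAdJ_one` (`Ad_1 = id`), (C) ⟹ (C)♯ and (C-tab) ⟹ (C-tab)♯ (witness `h = 1`); ★ `responseRowAtLT_of_rowL_table` — (E4a) `ResponseRowAtL` ∧ (C-tab) ⟹ (C)
  (and the ♯ version); ★★ `responseRowAtLT_of_tokP9reg_table` — UNDER TokP9-reg (the rooted entries `C²` at `0`, = P0's HypAn at the record; tree ✓ `PortU8.responseRowAtL_of_tokP9reg`)
  (C-tab) ALONE gives (C): **the (δ) exit's response-level leaf is, modulo P0, the table identity (C-tab)**.
* §4 ★ `chartSymm_recordAdJ` — the first conjunct of the road's RowLᵀ♯ binder is DISCHARGED at the record for every constant rotation: `ChartSymm (recordAct) (recordChartJ) n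
  (recordAdJ h)` from ▶ PTA-2's tree ✓ `BalabanUVNodesPortS1.chartEquivariantAtJ` through (L)'s `chartSymm_of_chartEquivariant`; and `chartSymm_one_record`.

HOW IT PLUGS IN.  The JOIN of record consumes (E4a) in the shape `∀ n a, ResponseRowAtL F θ k (recordK₀ + n) a` (✓ `…PortHRecordJoin` :168, fed to the road's RowL binder at :107);
the (δ)-JOIN consumes `∀ n a, ResponseRowAtLT(Symm) F θ k (recordK₀ + n) a` the same way into `Road.decay510_plimOf_of_rows_transverse(Symm)`'s RowLᵀ(♯) binder (leg labels
`l := R.e n μ z`), with `hfl := K0AxGaugeFlowRec.chartGaugeFlow_record` (leaf (B) ✓ HOME) and, for ♯, `chartSymm_recordAdJ`.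

LANDING NOTE (porter `ymgap-nodeO-port-PTB-1` g4, 2026-08-31): landed under ◆ CRIT-1 g35 CUT №2 (PASS ×3); §1's `recordGradLeg` DROPPED for the name of record
✓`K0AxGaugeFlowRec.recordGradLeg` (p813155, O-9) and §4's `chartSymm_recordAdJ` DROPPED for ✓`K0AxGaugeFlowRec.chartSymm_recordAdJ` (p813877, «one name on landing»); receipts and
bookkeeping theorems otherwise VERBATIM.  `--supports stmt-QuantumFields-27238 --as helper`.
HONEST FRAMING.  Receipts and bookkeeping only: (C)∕(C)♯∕(C-tab) are DISPLAYED, NOT proved — (C-tab) is Bałaban-strength content at the record ([15] Prop. 9∕(190) rooted-then-(21)-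
dressed response vs [B6] (2.35) Landau response: same linearised constrained variational problem ⟹ equal modulo linearised gauge; needs P0∕HypAn for the rooted side to be a
derivative at all) and is OPEN · M MODULO P0; S-wrap (J5′): an IDENTITY between named tables, no majorant ⟹ EXEMPT.  Nothing of Bałaban ([I] (4.8), (4.14)–(4.15), (4.35)–(4.37),
(5.10); [15]; [B6]) is asserted, ported or discharged; K0ᴬ `stmt-QuantumFields-27238` OPEN (stubs 1∕2); K0⁷ 20541 ASIDE; NODE O 0∕1; COUNT 8∕28 · K 1∕4 UNMOVED; ONE finite
`𝕋⁴_{L^K}` at fixed ε — NOT continuum ∕ OS ∕ Clay; **the Yang–Mills mass gap is NOT proved by any of this.**  No `sorry`, no `instance`, no `notation`; standard axioms.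
-/

noncomputable section

open scoped BigOperators Matrix.Norms.L2Operator

namespace Summit.QuantumFields.YangMills.Theorems.K0AxRowLTRec

open Literature.MathematicalPhysics.QuantumFieldTheory.Balaban1983to89
open Literature.MathematicalPhysics.QuantumFieldTheory.Balaban1983to89.Node00
open Literature.MathematicalPhysics.QuantumFieldTheory.Balaban1983to89.T4Continuum (T4Family)
open Summit.QuantumFields.YangMills.Theorems.K0RecordFormatNames
open Summit.QuantumFields.YangMills.Theorems (BalabanUVNodesPortS1.recordAdJ_apply BalabanUVNodesPortS1.sl2Coord_chartMatU BalabanUVNodesPortS1.sl2Coord_chartMatJc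
  BalabanUVNodesPortS1.chartEquivariantAtJ)

variable (F : T4Family)
open Summit.QuantumFields.YangMills.Theorems.K0AxGaugeFlowRec (recordGradLeg chartSymm_recordAdJ)

section Theta

variable (θ : Stage13Params F 2)

/-! ## §2  The receipts (C), (C)♯, (C-tab), (C-tab)♯ — displayed, assert nothing -/

/-- **RECEIPT (C) `ResponseRowAtLT F θ k K a` — RowLᵀ AT THE RECORD**: for every label `l`, the honest leg `D(recordEmbL)(0)·(δ_l ⊗ bV a)` of ⁸'s Landau-dressed chart and the
WHOLE-TORUS chart-unit transverse table `recordGkLocWξ … Finset.univ a l` differ by a lattice-gradient leg.  Displayed, NOT asserted (OPEN · M modulo P0).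
[cite: Balaban1987RG1, (4.35) p.290, (4.8) p.283, (4.15) p.284; Balaban1985Variational, Prop. 9 p.309, (21) p.281; Balaban1984PropagatorsII, (2.35) p.228] -/
def ResponseRowAtLT (k K : ℕ) (a : θ.ιβ) : Prop :=
  letI := θ.instVβ₁; letI := θ.instVβ₂; letI := θ.instιβ
  ∀ l : RespLabel F k K, ∃ φ : Site (F.P K) 0 → Fin 3 → ℂ, ∀ i : Fin (recordChartDimJ F K),
    fderiv ℝ (recordEmbL F θ k K) 0 (Pi.single l.1 (Pi.single l.2 (θ.bV a))) i - recordGkLocWξ F θ k K Finset.univ a l i = recordGradLeg F K φ i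

/-- **RECEIPT (C)♯ `ResponseRowAtLTSymm F θ k K a` — RowLᵀ♯ AT THE RECORD**: (C) modulo ONE GLOBAL ROTATION `recordAdJ h` of the transverse table, `h ∈ SU(2)` constant
(the root's surviving constant conjugation; ◆ CRIT-1's optional `Ad`-sharpening).  Displayed, NOT asserted.
[cite: Balaban1987RG1, (4.35) p.290, (4.8) p.283, (1.10) p.262; Balaban1985Variational, Prop. 9 p.309; Balaban1984PropagatorsII, (2.35) p.228] -/
def ResponseRowAtLTSymm (k K : ℕ) (a : θ.ιβ) : Prop :=
  letI := θ.instVβ₁; letI := θ.instVβ₂; letI := θ.instιβ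
  ∃ h : SU 2, ∀ l : RespLabel F k K, ∃ φ : Site (F.P K) 0 → Fin 3 → ℂ, ∀ i : Fin (recordChartDimJ F K),
    fderiv ℝ (recordEmbL F θ k K) 0 (Pi.single l.1 (Pi.single l.2 (θ.bV a))) i - recordAdJ F K h (recordGkLocWξ F θ k K Finset.univ a l) i = recordGradLeg F K φ i

/-- **RECEIPT (C-tab) `TableRowLT F θ k K a` — THE TABLE IDENTITY**: the Landau-dressed rooted response table `recordGkL a l` ([15] Prop. 9∕(190), (21)-dressed) and the
whole-torus (2.35) response table `recordGkLocWξ univ a l` ([B6]) differ by a lattice-gradient leg, label by label.  No `fderiv`; two NAMED tables.  Displayed, NOT asserted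
(OPEN · M modulo P0: `recordGkL`'s `𝐔`-block is a derivative of the rooted minimiser, honest only under HypAn).  ★★ DEF-1's toy: residual `3e-11` at `(3,9)`.
[cite: Balaban1985Variational, Prop. 9 p.309, (190) p.308, (21) p.281; Balaban1984PropagatorsII, (2.35) p.228, Sect. A; Balaban1987RG1, (4.35) p.290] -/
def TableRowLT (k K : ℕ) (a : θ.ιβ) : Prop :=
  ∀ l : RespLabel F k K, ∃ φ : Site (F.P K) 0 → Fin 3 → ℂ, ∀ i : Fin (recordChartDimJ F K),
    recordGkL F θ k K a l i - recordGkLocWξ F θ k K Finset.univ a l i = recordGradLeg F K φ i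

/-- **RECEIPT (C-tab)♯ `TableRowLTSymm F θ k K a`** — (C-tab) modulo one global rotation `recordAdJ h` of the transverse table.  Displayed, NOT asserted.
[cite: Balaban1985Variational, Prop. 9 p.309; Balaban1984PropagatorsII, (2.35) p.228; Balaban1987RG1, (4.8) p.283, (1.10) p.262] -/
def TableRowLTSymm (k K : ℕ) (a : θ.ιβ) : Prop :=
  ∃ h : SU 2, ∀ l : RespLabel F k K, ∃ φ : Site (F.P K) 0 → Fin 3 → ℂ, ∀ i : Fin (recordChartDimJ F K),
    recordGkL F θ k K a l i - recordAdJ F K h (recordGkLocWξ F θ k K Finset.univ a l) i = recordGradLeg F K φ i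

/-! ## §3  Bookkeeping: `Ad_1 = id`; (C) ⟹ (C)♯; (E4a) ∧ (C-tab) ⟹ (C); under TokP9-reg, (C-tab) ⟹ (C) -/

/-- `Ad_1 = id` on the two-block chart coordinates. [cite: Balaban1987RG1, (4.8) p.283 (bookkeeping)] -/
theorem recordAdJ_one (K : ℕ) (w : Fin (recordChartDimJ F K) → ℂ) : recordAdJ F K 1 w = w := by
  funext i
  obtain ⟨⟨b, c⟩, rfl⟩ := (chartEquivJ F K).surjective i
  rw [BalabanUVNodesPortS1.recordAdJ_apply]
  simp only [Equiv.symm_apply_apply, inv_one, OneMemClass.coe_one, one_mul, mul_one]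
  cases c with
  | inl a => simp only [Sum.elim_inl, BalabanUVNodesPortS1.sl2Coord_chartMatU]
  | inr a => simp only [Sum.elim_inr, BalabanUVNodesPortS1.sl2Coord_chartMatJc]

/-- (C) ⟹ (C)♯ (witness `h = 1`). [cite: Balaban1987RG1, (4.8) p.283 (bookkeeping)] -/
theorem responseRowAtLTSymm_of_LT (k K : ℕ) (a : θ.ιβ) (h : ResponseRowAtLT F θ k K a) : ResponseRowAtLTSymm F θ k K a := by
  letI := θ.instVβ₁; letI := θ.instVβ₂; letI := θ.instιβ
  refine ⟨1, fun l => ?_⟩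
  obtain ⟨φ, hφ⟩ := h l
  exact ⟨φ, fun i => by rw [recordAdJ_one]; exact hφ i⟩

/-- (C-tab) ⟹ (C-tab)♯ (witness `h = 1`). [cite: Balaban1987RG1, (4.8) p.283 (bookkeeping)] -/
theorem tableRowLTSymm_of_LT (k K : ℕ) (a : θ.ιβ) (h : TableRowLT F θ k K a) : TableRowLTSymm F θ k K a := by
  refine ⟨1, fun l => ?_⟩
  obtain ⟨φ, hφ⟩ := h l
  exact ⟨φ, fun i => by rw [recordAdJ_one]; exact hφ i⟩

/-- ★ **(E4a) ∧ (C-tab) ⟹ (C)**: with ⁸'s RowL `D(recordEmbL)(0)·(δ_l ⊗ bV a) = recordGkL a l` (ed.14 receipt (E4a), tree ✓ under TokP9-reg), RowLᵀ at the record IS the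
table identity. [cite: Balaban1985Variational, Prop. 9 p.309; Balaban1987RG1, (4.35) p.290 (bookkeeping)] -/
theorem responseRowAtLT_of_rowL_table (k K : ℕ) (a : θ.ιβ) (hL : ResponseRowAtL F θ k K a) (hT : TableRowLT F θ k K a) : ResponseRowAtLT F θ k K a := by
  letI := θ.instVβ₁; letI := θ.instVβ₂; letI := θ.instιβ
  intro l
  obtain ⟨φ, hφ⟩ := hT l
  exact ⟨φ, fun i => by rw [hL l i]; exact hφ i⟩

/-- ★ **(E4a) ∧ (C-tab)♯ ⟹ (C)♯**. [cite: Balaban1985Variational, Prop. 9 p.309; Balaban1987RG1, (4.35) p.290, (4.8) p.283 (bookkeeping)] -/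
theorem responseRowAtLTSymm_of_rowL_tableSymm (k K : ℕ) (a : θ.ιβ) (hL : ResponseRowAtL F θ k K a) (hT : TableRowLTSymm F θ k K a) :
    ResponseRowAtLTSymm F θ k K a := by
  letI := θ.instVβ₁; letI := θ.instVβ₂; letI := θ.instιβ
  obtain ⟨h, hh⟩ := hT
  refine ⟨h, fun l => ?_⟩
  obtain ⟨φ, hφ⟩ := hh l
  exact ⟨φ, fun i => by rw [hL l i]; exact hφ i⟩

/-- Conversely (C) ∧ (E4a) ⟹ (C-tab): under RowL the two receipts are the same statement. [cite: Balaban1985Variational, Prop. 9 p.309 (bookkeeping)] -/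
theorem tableRowLT_of_rowL_responseRowAtLT (k K : ℕ) (a : θ.ιβ) (hL : ResponseRowAtL F θ k K a) (hC : ResponseRowAtLT F θ k K a) : TableRowLT F θ k K a := by
  letI := θ.instVβ₁; letI := θ.instVβ₂; letI := θ.instιβ
  intro l
  obtain ⟨φ, hφ⟩ := hC l
  exact ⟨φ, fun i => by rw [← hL l i]; exact hφ i⟩

/-- ★★ **UNDER TokP9-reg (= P0's HypAn at the record), THE TABLE IDENTITY ALONE GIVES (C)**: the rooted entries `C²` at `0` (standing range `k + 1 ≤ m + K`, `0 < εbg`) make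
(E4a) a tree theorem (✓ `PortU8.responseRowAtL_of_tokP9reg`), so RowLᵀ at the record reduces to (C-tab) — the (δ) exit's response-level leaf is, MODULO P0, an identity between
two named tables. [cite: Balaban1985Variational, Prop. 9 p.309, (190) p.308, (21) p.281; Balaban1987RG1, (4.35) p.290; Balaban1984PropagatorsII, (2.35) p.228] -/
theorem responseRowAtLT_of_tokP9reg_table (k K : ℕ) (hk : k + 1 ≤ (F.P K).m + (F.P K).K) (hε : 0 < θ.εbg)
    (hd2 : letI := θ.instVβ₁; letI := θ.instVβ₂;
      ContDiffAt ℝ 2 (fun B : Fin (F.P K).d → Site (F.P K) (k + 1) → θ.Vβ =>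
        fun (b : PBond (F.P K) 0) (i i' : Fin 2) => ((recordBgField F θ k K B b : SU 2) : MatA 2) i i') 0)
    (a : θ.ιβ) (hT : TableRowLT F θ k K a) : ResponseRowAtLT F θ k K a :=
  responseRowAtLT_of_rowL_table F θ k K a (PortU8.responseRowAtL_of_tokP9reg F θ k K hk hε hd2 a) hT

/-- ★★ The ♯ version under TokP9-reg. [cite: Balaban1985Variational, Prop. 9 p.309; Balaban1987RG1, (4.35) p.290, (4.8) p.283] -/
theorem responseRowAtLTSymm_of_tokP9reg_tableSymm (k K : ℕ) (hk : k + 1 ≤ (F.P K).m + (F.P K).K) (hε : 0 < θ.εbg)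
    (hd2 : letI := θ.instVβ₁; letI := θ.instVβ₂;
      ContDiffAt ℝ 2 (fun B : Fin (F.P K).d → Site (F.P K) (k + 1) → θ.Vβ =>
        fun (b : PBond (F.P K) 0) (i i' : Fin 2) => ((recordBgField F θ k K B b : SU 2) : MatA 2) i i') 0)
    (a : θ.ιβ) (hT : TableRowLTSymm F θ k K a) : ResponseRowAtLTSymm F θ k K a :=
  responseRowAtLTSymm_of_rowL_tableSymm F θ k K a (PortU8.responseRowAtL_of_tokP9reg F θ k K hk hε hd2 a) hT

end Theta


/-! ## §4  The road's `ChartSymm` conjunct at the record: the identity is a chart symmetry (the rotations: ✓`K0AxGaugeFlowRec.chartSymm_recordAdJ`) -/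

/-- `ChartSymm … n 1` at the record (witness `recordToG 1`, which acts trivially). [cite: Balaban1987RG1, (1.10) p.262 (u = 1)] -/
theorem chartSymm_one_record (Mc k : ℕ) (K : ℕ → ℕ) (n : ℕ) :
    B12ChartGaugeFlow48.ChartSymm (S := fun n => recordDomSys F Mc k (K n)) (M := fun n => recordBondCount F (K n)) (m := fun n => recordChartDimJ F (K n))
      (Gg := fun n => recordGaugeGrp F (K n)) (fun n => recordAct F (K n)) (fun n => recordChartJ F Mc k (K n)) n 1 := by
  have h := chartSymm_recordAdJ F Mc k K n 1
  obtain ⟨g, hg⟩ := h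
  exact ⟨g, fun X u => by rw [← hg X u, recordAdJ_one]; rfl⟩

end Summit.QuantumFields.YangMills.Theorems.K0AxRowLTRec

end
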